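import Literature.NumberTheory.EllipticCurves.Wuthrich2014.ReducibleDivisibility
import Literature.NumberTheory.EllipticCurves.LeadingTermPPartEisensteinProofs
import Literature.NumberTheory.EllipticCurves.IwasawaLeadingTerm
import HarnessLib

/-!
# The `p`-adic BSD inequality at a reducible good ordinary prime `p ≥ 5` (Wuthrich 2014 §6 made precise)

`Proofs` companion (theorems only; no new definition, no new named fact) of
`Literature.NumberTheory.EllipticCurves.Wuthrich2014.ReducibleDivisibility`. HONEST FRAMING (BSD
rank-≤1 residual cell `b2b-bsdres`): the rank-`1` part of class X1 (Eisenstein anomalous good `p`)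
has NO class theorem in print; what the published record gives class-wide is an UPPER BOUND on
`Ш[p^∞]` by a `p`-adic analytic quantity — the "`p`-adic BSD inequality" of Stein–Wuthrich, Math.
Comp. 82 (2013) (printed under surjective `ρ̄`), of which Wuthrich, Doc. Math. 19 (2014), §6 says
only "The methods in [SW] can now be extended to the reducible case, too." This file makes that
sentence a kernel-checked theorem, assembled from PUBLISHED statements of the tree:

* Wuthrich 2014 Thm. 16 (`charIdeal_dvd_padicLFunction`): `ϖ · L_p(f, α) = ι g`, `g ∈ char_Λ X = (f_E)`;
* Perrin-Riou / Schneider 1985 as printed by Balakrishnan–Müller–Stein, Math. Comp. 85 (2016),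
  Thm. 1.7 (`Schneider1985_order_charGenerator`, `p ≥ 5`): `ord_T f_E ≥ r = rank E(ℚ)`, with
  equality iff `Reg_p ≠ 0` and `Ш[p^∞]` finite, and then
  `[T^r] f_E · log_p(γ)^r · #E(ℚ)_tors² ∼ (1 - α⁻¹)² · #Ш[p^∞] · Reg_p · ∏ c_ℓ`.

**Theorem** (`padicBSD_inequality_of_charIdeal_dvd`). If moreover the `p`-adic `L`-function has
order of vanishing EXACTLY `r = rank E(ℚ)` at `T = 0` (a per-curve `p`-adic computation — the
hypothesis `hord`; conjecturally always, Mazur–Tate–Teitelbaum), then: `Ш(E/ℚ)[p^∞]` is finite, the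
canonical `p`-adic height is non-degenerate (`SchneiderConjecture`), and
`ord_p #Ш(E/ℚ)[p^∞] + ord_p((1 - α⁻¹)² · Reg_p · ∏ c_ℓ) ≤ ord_p(ϖ · [T^r]L_p · log_p(γ)^r · #E(ℚ)_tors²)`,
i.e. `#Ш[p^∞]` divides the `p`-adic analytic order of `Ш` (up to a `p`-adic unit). Proof: write
`g = h · f_E`; comparing orders at `T = 0`, `ord_T(ι g) = ord_T L_p = r ≤ ord_T f_E` forces
`ord_T f_E = r` and `h(0) · [T^r]f_E = [T^r]g = ϖ [T^r]L_p ≠ 0`; Perrin-Riou–Schneider then gives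
finiteness, non-degeneracy and the leading-term identity, and `ord_p h(0) ≥ 0` is the inequality.
The missing reverse inequality is again `ord_p h(0) = 0`. Class-wide content for X1 ∩ {r = 1}: a
BOUND, conditional on the computed `ord_T L_p = 1`, at `p ≥ 5` only (the tree's Perrin-Riou–Schneider
fact is stated for `p ≥ 5`; 235 of the 259 census pairs are at `p = 3`).

References: [Wuthrich2014] Thm. 16, §6; [SteinWuthrich2013] §§3–4 (the inequality under
surjectivity); [BalakrishnanMullerStein2015] Thm. 1.7; [GreenbergLNM1716] §4 p. 110.
-/

set_option autoImplicit false

noncomputable section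

open scoped Classical MatrixGroups ModularForm

open CongruenceSubgroup WeierstrassCurve Literature.NumberTheory.EllipticCurves
  Literature.NumberTheory.EllipticCurves.ModularForms

namespace Literature.NumberTheory.EllipticCurves.Wuthrich2014

/-- `ι = iwasawaToPowerSeries p` commutes with coefficients: `[T^n](ι g) = [T^n] g` in `ℚ_p`.
[folklore] -/
theorem coeff_iwasawaToPowerSeries (p : ℕ) [Fact p.Prime] (g : IwasawaAlgebra p) (n : ℕ) :
    PowerSeries.coeff n (iwasawaToPowerSeries p g) = ((PowerSeries.coeff n g : ℤ_[p]) : ℚ_[p]) := by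
  rw [iwasawaToPowerSeries, PowerSeries.coeff_map]
  rfl

/-- **The `p`-adic BSD inequality at a reducible good ordinary prime `p ≥ 5`** (Wuthrich 2014, §6:
"The methods in [Stein–Wuthrich] can now be extended to the reducible case", assembled from Thm. 16
and the Perrin-Riou–Schneider leading-term theorem). Let `W` be a globally minimal model of `E/ℚ`,
`p ≥ 5` good ordinary (`hgood`, `hordp`) with `E[p]` reducible (`hred`), `f` a newform of `E`
(`hf`), `ϖ ≠ 0` the rational with `ϖ · Ω_E = Ω⁺_f` (`hϖ`), `Dh` THE canonical `p`-adic height datum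
(`hDh`), `r = rank E(ℚ)`. Assume Wuthrich's Thm. 16 (`hW16`), Perrin-Riou–Schneider (`hS`), and that
`L_p(f, α)` vanishes to order EXACTLY `r` at `T = 0` (`hord`). Then `Ш(E/ℚ)[p^∞]` is finite,
`Reg_p(E, Dh) ≠ 0`, and
`ord_p #Ш[p^∞] + ord_p((1 - α⁻¹)² Reg_p ∏ c_ℓ) ≤ ord_p(ϖ [T^r]L_p · log_p(γ_cyc)^r · #E(ℚ)_tors²)`.
[cite: Wuthrich2014, Thm. 16 (p. 393) and §6 (p. 400)] [cite: BalakrishnanMullerStein2015, Thm. 1.7]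
[cite: SteinWuthrich2013, §§3–4] -/
theorem padicBSD_inequality_of_charIdeal_dvd (hW16 : charIdeal_dvd_padicLFunction)
    (hS : Schneider1985_order_charGenerator)
    (W : WeierstrassCurve ℚ) [W.IsElliptic] [W.IsGloballyMinimal] (p : ℕ) [Fact p.Prime]
    (hp : 5 ≤ p) (hgood : W.HasGoodReductionAtPrime p) (hordp : ¬ (p : ℤ) ∣ W.frobeniusTrace p)
    (hred : ¬ W.HasIrreducibleModPGaloisRep p)
    {N : ℕ} [NeZero N] (f : CuspForm (Gamma0 N) 2) (hf : IsNewformOf W f)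
    (ϖ : ℚ) (hϖ0 : ϖ ≠ 0) (hϖ : (ϖ : ℝ) * W.realPeriodRat = plusPeriod f)
    (Dh : PAdicHeightData W p) (hDh : Dh.IsCanonical)
    (hord : (padicLFunction f (unitRoot W p : ℚ_[p])).order = W.mordellWeilRank) :
    Finite (AddCommGroup.primaryComponent W.sha p) ∧ SchneiderConjecture Dh ∧
      (padicValNat p (Nat.card (AddCommGroup.primaryComponent W.sha p)) : ℤ) +
          ((1 - (unitRoot W p : ℚ_[p])⁻¹) ^ 2 * (padicRegulator Dh * W.tamagawaProduct)).valuation ≤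
        ((ϖ : ℚ_[p]) * PowerSeries.coeff W.mordellWeilRank (padicLFunction f (unitRoot W p : ℚ_[p])) *
          padicLog p (cyclotomicGenerator p) ^ W.mordellWeilRank * (W.torsionOrder : ℚ_[p]) ^ 2).valuation := by
  have hpP : p.Prime := Fact.out
  have hp2 : p ≠ 2 := by omega
  have hordin : IsOrdinaryAt W p := ⟨hgood, hordp⟩
  set r := W.mordellWeilRank with hr_def
  set L := padicLFunction f (unitRoot W p : ℚ_[p]) with hL_def
  -- Step 1: the cyclotomic setting and the Iwasawa module
  obtain ⟨κ, hκ, γ, hγ, hγ'⟩ := exists_isCyclotomic_isTopGenerator_isCyclotomicVariable_holds p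
  obtain ⟨D⟩ := W.nonempty_selmerDualData_holds κ γ hγ
  haveI : Module.Finite (IwasawaAlgebra p) D.X := D.module_finite_holds hγ
  -- Step 2: Wuthrich's Thm. 16 and a generator of the characteristic ideal
  obtain ⟨hX, g, hgmem, hιg⟩ := hW16 W p hp2 hordin hred hκ hγ hγ' hf D ϖ hϖ
  haveI : (Module.charIdeal (IwasawaAlgebra p) D.X).IsPrincipal := charIdeal_isPrincipal_holds p D.X
  obtain ⟨fE, hchar⟩ := Submodule.IsPrincipal.principal (Module.charIdeal (IwasawaAlgebra p) D.X)
  have hchar' : D.charIdeal = Ideal.span {fE} := hchar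
  have hgmem' : g ∈ Ideal.span {fE} := by rw [← hchar']; exact hgmem
  obtain ⟨h, hgh⟩ := Ideal.mem_span_singleton'.mp hgmem'
  -- Step 3: Perrin-Riou–Schneider, clause 1: `T^r ∣ fE`, so `fE = T^r · q`
  obtain ⟨q, hq⟩ := Schneider1985_order_charGenerator.X_pow_dvd hS hp hgood hordp hκ hγ hγ' D hX hchar' hDh
  -- Step 4: coefficients at `T^r`: `ϖ · [T^r] L = [T^r](ι g) = h(0) · q(0)` and `[T^r] fE = q(0)`
  have hcoeffL : PowerSeries.coeff r L ≠ 0 := by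
    have hL0 : L ≠ 0 := by
      intro h0
      rw [h0, PowerSeries.order_zero] at hord
      exact ENat.top_ne_coe _ hord
    have h1 := PowerSeries.coeff_order hL0
    rwa [hord, ENat.toNat_coe] at h1
  have hcoeff_g : (PowerSeries.coeff r g : ℤ_[p]) =
      PowerSeries.constantCoeff h * PowerSeries.constantCoeff q := by
    rw [← hgh, hq, show h * (PowerSeries.X ^ r * q) = PowerSeries.X ^ r * (h * q) by ring,
      PowerSeries.coeff_X_pow_mul', if_pos le_rfl, Nat.sub_self,
      PowerSeries.coeff_zero_eq_constantCoeff, map_mul]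
  have hcoeff_fE : (PowerSeries.coeff r fE : ℤ_[p]) = PowerSeries.constantCoeff q := by
    rw [hq, PowerSeries.coeff_X_pow_mul', if_pos le_rfl, Nat.sub_self,
      PowerSeries.coeff_zero_eq_constantCoeff]
  have hcoeff_ιg : ((PowerSeries.coeff r g : ℤ_[p]) : ℚ_[p]) = (ϖ : ℚ_[p]) * PowerSeries.coeff r L := by
    rw [← coeff_iwasawaToPowerSeries p g r, hιg, PowerSeries.coeff_C_mul]
  -- hence `h(0) ≠ 0`, `q(0) ≠ 0`, and `ord_T fE = r`
  have hϖQ : (ϖ : ℚ_[p]) ≠ 0 := by exact_mod_cast hϖ0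
  have hg_r_ne : (PowerSeries.coeff r g : ℤ_[p]) ≠ 0 := by
    intro h0
    have : ((PowerSeries.coeff r g : ℤ_[p]) : ℚ_[p]) = 0 := by rw [h0]; rfl
    rw [hcoeff_ιg] at this
    exact (mul_ne_zero hϖQ hcoeffL) this
  have hh0 : PowerSeries.constantCoeff h ≠ 0 := by
    intro h0; apply hg_r_ne; rw [hcoeff_g, h0, zero_mul]
  have hq0 : PowerSeries.constantCoeff q ≠ 0 := by
    intro h0; apply hg_r_ne; rw [hcoeff_g, h0, mul_zero]
  have hordfE : fE.order = r := by
    refine le_antisymm (PowerSeries.order_le r (by rw [hcoeff_fE]; exact hq0)) ?_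
    exact Schneider1985_order_charGenerator.mordellWeilRank_le_order hS hp hgood hordp hκ hγ hγ' D hX
      hchar' hDh
  -- Step 5: Perrin-Riou–Schneider, clauses 2 and 3
  obtain ⟨hSch, hfin⟩ := (Schneider1985_order_charGenerator.order_eq_iff hS hp hgood hordp hκ hγ hγ'
    D hX hchar' hDh).mp hordfE
  obtain ⟨u, hu⟩ := Schneider1985_order_charGenerator.leadingCoeff hS hp hgood hordp hκ hγ hγ' D hX
    hchar' hDh hSch hfin
  refine ⟨hfin, hSch, ?_⟩
  haveI := hfin
  -- Step 6: the identity `ϖ [T^r]L · log^r · T² = h(0) · (u · ε · #Ш[p^∞] · Reg · ∏c)` in `ℚ_p`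
  set h0 : ℚ_[p] := ((PowerSeries.constantCoeff h : ℤ_[p]) : ℚ_[p]) with hh0_def
  set lg : ℚ_[p] := padicLog p (cyclotomicGenerator p) ^ r with hlg_def
  set T2 : ℚ_[p] := (W.torsionOrder : ℚ_[p]) ^ 2 with hT2_def
  set ε : ℚ_[p] := (1 - (unitRoot W p : ℚ_[p])⁻¹) ^ 2 with hε_def
  set Shp : ℚ_[p] := (Nat.card (AddCommGroup.primaryComponent W.sha p) : ℚ_[p]) with hShp_def
  set RegC : ℚ_[p] := padicRegulator Dh * W.tamagawaProduct with hRegC_def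
  have key : (ϖ : ℚ_[p]) * PowerSeries.coeff r L * lg * T2 =
      h0 * (((u : ℤ_[p]) : ℚ_[p]) * (ε * (Shp * RegC))) := by
    have e1 : (ϖ : ℚ_[p]) * PowerSeries.coeff r L =
        h0 * ((PowerSeries.coeff r fE : ℤ_[p]) : ℚ_[p]) := by
      rw [← hcoeff_ιg, hcoeff_g, hcoeff_fE, hh0_def]; push_cast; ring
    calc (ϖ : ℚ_[p]) * PowerSeries.coeff r L * lg * T2
        = h0 * (((PowerSeries.coeff r fE : ℤ_[p]) : ℚ_[p]) * lg * T2) := by rw [e1]; ring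
      _ = h0 * (((u : ℤ_[p]) : ℚ_[p]) * (ε * (Shp * RegC))) := by
          rw [hu, hRegC_def]; ring
  -- Step 7: non-vanishing of the factors
  have hh0ne : h0 ≠ 0 := by
    rw [hh0_def]; intro e; exact hh0 (by exact_mod_cast (PadicInt.coe_eq_zero.mp e))
  have hh0val : 0 ≤ h0.valuation := by rw [hh0_def]; exact PadicInt.valuation_coe_nonneg
  obtain ⟨u₂, hu₂⟩ := exists_unit_one_sub_unitRoot_inv p W hordin
  have hε0 : ε ≠ 0 := by
    rw [hε_def, hu₂]
    refine pow_ne_zero 2 (mul_ne_zero (coe_units_ne_zero p u₂) ?_)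
    exact_mod_cast (W.reductionPointCount_pos p).ne'
  have hShp0 : Shp ≠ 0 := by rw [hShp_def]; exact_mod_cast Nat.card_pos.ne'
  have hc0 : (W.tamagawaProduct : ℚ_[p]) ≠ 0 := by
    exact_mod_cast (W.tamagawaProduct_pos_holds : 0 < W.tamagawaProduct).ne'
  have hRegC0 : RegC ≠ 0 := by rw [hRegC_def]; exact mul_ne_zero hSch hc0
  have hrhs0 : ((u : ℤ_[p]) : ℚ_[p]) * (ε * (Shp * RegC)) ≠ 0 :=
    mul_ne_zero (coe_units_ne_zero p u) (mul_ne_zero hε0 (mul_ne_zero hShp0 hRegC0))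
  -- Step 8: valuations
  have hval := congrArg Padic.valuation key
  rw [Padic.valuation_mul hh0ne hrhs0, Padic.valuation_mul (coe_units_ne_zero p u)
      (mul_ne_zero hε0 (mul_ne_zero hShp0 hRegC0)), valuation_coe_units_eq_zero, zero_add,
    Padic.valuation_mul hε0 (mul_ne_zero hShp0 hRegC0), Padic.valuation_mul hShp0 hRegC0] at hval
  have hvS : Shp.valuation = (padicValNat p (Nat.card (AddCommGroup.primaryComponent W.sha p)) : ℤ) := by
    rw [hShp_def, Padic.valuation_natCast]
  have hεR : (ε * RegC).valuation = ε.valuation + RegC.valuation := Padic.valuation_mul hε0 hRegC0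
  rw [show (1 - (unitRoot W p : ℚ_[p])⁻¹) ^ 2 * (padicRegulator Dh * W.tamagawaProduct) = ε * RegC
    from rfl, hεR, ← hvS]
  rw [show (ϖ : ℚ_[p]) * PowerSeries.coeff r L * padicLog p (cyclotomicGenerator p) ^ r *
      (W.torsionOrder : ℚ_[p]) ^ 2 = (ϖ : ℚ_[p]) * PowerSeries.coeff r L * lg * T2 from rfl, hval]
  linarith

end Literature.NumberTheory.EllipticCurves.Wuthrich2014

end
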